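import Mathlib
import Summits.Ventures.HodgeRepro2.A2WeilProjectionPeriod
import Summits.Ventures.HodgeRepro2.A2PontryaginDegree

/-!
# A2 annex — the twelve-plane instance: the statements of sub-claim A2 with their printed numbers

Sub-claim A2 (route/T4-A2-p6.md v6) lives on `B = A₁ × ⋯ × A₄` of dimension `12`, `H^*(B, ℂ) = ⋀^*`
of a `24`-dimensional space with twelve planes, `|P₀| = 4` Weil planes per embedding, `θ⁴`, `θ⁸`,
`f_*c_j ∈ H^{22}`, `z = f_*(1_S) ∈ H^{20}`, `y = z ⋆ θ⁴ ∈ H⁴`.  This file instantiates the general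
model theorems of the annex on `ι = Fin 12` so that they read with the section's numbers:

* **`weilCoordinate_gysinTriple_eq_zero_twelve`** (Corollary A8.2): for `z₂ ∈ ⋀^{22}` with
  `∫_B z₂ ∧ e_{a,σ} ∧ e_{b,σ} = 0` (`a ≠ b` in `P₀`, `|P₀| = 4`) and all `c_p ≠ 0`, every Weil
  coordinate of `y' = m₃_*(z₁ ⊗ z₂ ⊗ θ⁴)` vanishes;
* **`pontryagin_theta_pow_mem_grading_twelve`** ((S3)): `z ∈ ⋀^{20} ⇒ z ⋆ θ⁴ ∈ ⋀^4`;
* **`integral_pontryagin_theta_pow_mul_weil_twelve`** (Prop. A5.5): `∫_B (z ⋆ θ⁴) ∧ θ⁸ ∧ w_σ =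
  8! · 4! · (∏ c) · vol · ∫_B z ∧ w_σ` for `|P₀| = 4`;
* **`weilProjModel_pontryagin_ne_zero_iff_twelve`** ((N)): `p_W(z ⋆ θ⁴) ≠ 0 ↔ ∃ σ, ∫_B z ∧ w_σ ≠ 0`
  over any family of Weil data of size `4`.

Seat p6 (A2 owner), gen 16.  §8 (d): uses an L-value-free non-vanishing device: NO.
-/

namespace Summit.Ventures.HodgeRepro2.A2TwelvePlanes

open WeilPlanes WeilIntegral WeilDetect A2TripleSumPairing A2ModelDuality A2PontryaginModel
  A2WeilProjection A2WeilProjectionPeriod A2TripleSumGysin A2PontryaginDegree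

/-- The twelve planes. -/
abbrev ι₁₂ : Type := Fin 12

/-- `2|ι| − 2 = 22`, `2|ι| − 4 = 20` on twelve planes. -/
theorem card_twelve : Fintype.card ι₁₂ = 12 := Fintype.card_fin 12

/-- **Corollary A8.2 on twelve planes.** -/
theorem weilCoordinate_gysinTriple_eq_zero_twelve (P₀ : Finset ι₁₂) (hP : P₀.card = 4) (s : Bool)
    (c : ι₁₂ → ℂ) (hc : ∀ p, c p ≠ 0) (z₁ : A ι₁₂) {z₂ : A ι₁₂}
    (hz₂ : z₂ ∈ (⋀[ℂ]^22 (V ι₁₂) : Submodule ℂ (A ι₁₂)))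
    (hA81 : ∀ a ∈ P₀, ∀ b ∈ P₀, a ≠ b → integral (z₂ * (gen (a, s) * gen (b, s))) = 0) :
    integral (gysinTriple (integral ∘ₗ LinearMap.mulLeft ℂ z₁) (integral ∘ₗ LinearMap.mulLeft ℂ z₂)
      (psi c 4) * (ET (Finset.univ \ P₀) * weil P₀ s)) = 0 := by
  have h := weilCoordinate_gysinTriple_eq_zero (ι := ι₁₂) (by rw [card_twelve]; norm_num) P₀ s c hc
    z₁ (by simpa [card_twelve] using hz₂) hA81
  rwa [hP] at h

/-- **(S3) on twelve planes**: `z ∈ ⋀^{20} ⇒ z ⋆ θ⁴ ∈ ⋀^4`. -/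
theorem pontryagin_theta_pow_mem_grading_twelve {z : A ι₁₂}
    (hz : z ∈ (⋀[ℂ]^20 (V ι₁₂) : Submodule ℂ (A ι₁₂))) (c : ι₁₂ → ℂ) :
    pontryagin z (theta c ^ 4) ∈ (⋀[ℂ]^4 (V ι₁₂) : Submodule ℂ (A ι₁₂)) :=
  pontryagin_theta_pow_mem_grading (by rw [card_twelve]; norm_num) (by simpa [card_twelve] using hz) c

/-- **Proposition A5.5 on twelve planes**: `∫_B (z ⋆ θ⁴) ∧ θ⁸ ∧ w_σ = 8! 4! (∏ c) vol ∫_B z ∧ w_σ`. -/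
theorem integral_pontryagin_theta_pow_mul_weil_twelve (P₀ : Finset ι₁₂) (hP : P₀.card = 4)
    (s : Bool) (c : ι₁₂ → ℂ) (z : A ι₁₂) :
    integral (pontryagin z (theta c ^ 4) * (theta c ^ 8 * weil P₀ s)) =
      ((((8 : ℕ).factorial : ℂ) * ((4 : ℕ).factorial : ℂ) * ∏ p, c p) * vol ι₁₂) *
        integral (z * weil P₀ s) := by
  have h := integral_pontryagin_theta_pow_mul_weil P₀ s c z
  have hI : (Finset.univ \ P₀).card = 8 := by
    rw [Finset.card_univ_sdiff, card_twelve, hP]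
  rwa [hP, hI, weilConstant, hI, hP] at h

/-- **(N) on twelve planes**: `p_W(z ⋆ θ⁴) ≠ 0 ↔ ∃ σ, ∫_B z ∧ w_σ ≠ 0`. -/
theorem weilProjModel_pontryagin_ne_zero_iff_twelve (W : Finset (Finset ι₁₂ × Bool))
    (hW : ∀ d ∈ W, d.1.card = 4) (c : ι₁₂ → ℂ) (hc : ∀ p, c p ≠ 0) (z : A ι₁₂) :
    weilProjModel W (pontryagin z (theta c ^ 4)) ≠ 0 ↔
      ∃ d ∈ W, integral (z * weil d.1 (!d.2)) ≠ 0 :=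
  weilProjModel_pontryagin_ne_zero_iff W 4 (by norm_num) hW c hc z

end Summit.Ventures.HodgeRepro2.A2TwelvePlanes
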